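import Literature.RingTheory.KrullDimension.EagonNorthcottMinorsProofs
import Literature.RingTheory.KrullDimension.HomogeneousHeightZero
import Literature.Computability.AlgebraicComplexity.PencilFamily
import Literature.Computability.AlgebraicComplexity.ABV17SingularLocusBound
import Mathlib.Analysis.Complex.Polynomial.Basic

/-!
# Route BarrierLever — low-order vanishing of affine determinants along the low-rank locus of the
# linear part (tools for the `dc ≤ n + k` rung of crux `DefinableDcEquations`, stmt-ValiantsHypothesis-8746)

Support file for `BarrierLeverDefinableDcEquationsConstantExcess.lean` (algebraic natural proofs
against determinantal complexity `n + k` for every constant `k`).  Four self-contained tools, all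
over a commutative ring except §4 (over `ℂ`):

* §1 `det_mem_minorsIdeal_of_eq_off` — **low-order vanishing of determinants, ideal form**: if a
  square matrix `B` agrees with `A` outside `#S` rows and `#T` columns and `t + #S + #T ≤ m`, then
  `det B ∈ I_t(A)` (the ideal of `t × t` minors of `A`, the tree's `minorsIdeal`); Laplace expansion
  along the exceptional rows and columns (`Matrix.det_succ_row` / `det_succ_column`, induction on
  the size).  Point form `det_eq_zero_of_eq_off`.
* §2 `homogeneousComponent_det_eq_sum_powersetCard` — for an affine matrix `M = M₀ + M₁(x)` of size
  `d + k`, `hc_d (det M) = Σ_{#T = k} det (columns in T from M₀, the others from M₁(x))` (the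
  coefficient of `ℓ^k` of the pencil determinant `det (ℓ M₀ + M₁(x))`; `k = 0` is the tree's
  `homogeneousComponent_card_det_of_totalDegree_le_one`).
* §3 `eval_homogeneousComponent_det_eq_zero`, `eval_pderiv_homogeneousComponent_det_eq_zero` — at a
  point `ξ` where all `(d-1)`-minors of `M₁(ξ)` vanish (corank `≥ k + 2`), the degree-`d` component
  of `det M` vanishes TOGETHER WITH ITS GRADIENT (row-by-row derivative `VonZurGathen.derivation_det`
  + §1 with one exceptional row and `k` exceptional columns).
* §4 `exists_ne_zero_minorsIdeal_eval_eq_bot` — a square matrix of linear forms in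
  `w > (m - t + 1)²` variables over `ℂ` has a NONZERO point killing all its `t`-minors: the ideal
  `I_t` is homogeneous and proper, of height `≤ (m - t + 1)²` by **Eagon–Northcott** (Matsumura
  Thm. 13.10 = Bruns–Vetter Thm. 2.1, PROVED in the tree: `height_minorsIdeal_le`), and a
  homogeneous ideal of height `< w` has a nonzero zero
  (`exists_ne_zero_common_zero_of_isHomogeneous_of_height_lt`).

Nothing here bears on `VP` vs `VNP`.  No definitions, no named-fact hypotheses; standard axioms.

References: H. Matsumura, *Commutative Ring Theory*, Thm. 13.10 [Matsumura1987]; W. Bruns,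
U. Vetter, *Determinantal Rings*, Thm. (2.1) [BrunsVetter1988]; J. M. Landsberg, *Geometry and
Complexity Theory* (2017) §6.1.6 (pencil determinants) [Landsberg2017].
-/

-- layout Summits/ValiantsHypothesis/ValiantsHypothesis forces the duplicated namespace component
set_option linter.dupNamespace false

noncomputable section

open MvPolynomial Finset Matrix

namespace Summit.ValiantsHypothesis.ValiantsHypothesis.Theorems.BarrierLever.DcConstantExcess

open Literature.Computability.AlgebraicComplexity
open Literature.RingTheory.KrullDimension

/-! ## §1 Low-order vanishing: determinants agreeing with `A` off few rows and columns lie in `I_t(A)` -/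

section Minors

variable {R : Type*} [CommRing R]

/-- Minors of a submatrix are minors: `I_t(A.submatrix f g) ⊆ I_t(A)`. [folklore] -/
theorem minorsIdeal_submatrix_le {m n m' n' : Type*} (t : ℕ) (A : Matrix m n R) (f : m' → m)
    (g : n' → n) : minorsIdeal t (A.submatrix f g) ≤ minorsIdeal t A := by
  rw [minorsIdeal, Ideal.span_le]
  rintro _ ⟨⟨ρ, γ⟩, rfl⟩
  show ((A.submatrix f g).submatrix ρ γ).det ∈ minorsIdeal t A
  rw [Matrix.submatrix_submatrix]
  exact det_submatrix_mem_minorsIdeal t A _ _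

/-- Pulling a finite set of indices back along `p.succAbove` loses the index `p`:
`#{j : p.succAbove j ∈ T} ≤ #(T.erase p)`. [folklore] -/
theorem card_filter_succAbove_mem_le {m : ℕ} (p : Fin (m + 1)) (T : Finset (Fin (m + 1))) :
    (univ.filter fun j : Fin m => p.succAbove j ∈ T).card ≤ (T.erase p).card := by
  rw [← Finset.card_map (Fin.succAboveEmb p)]
  refine Finset.card_le_card fun x hx => ?_
  rw [Finset.mem_map] at hx
  obtain ⟨j, hj, rfl⟩ := hx
  rw [Finset.mem_filter] at hj
  exact Finset.mem_erase.2 ⟨Fin.succAbove_ne p j, hj.2⟩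

/-- **Low-order vanishing of determinants, ideal form.** If a square matrix `B` agrees with `A`
outside a set `S` of rows and a set `T` of columns, and `t + #S + #T ≤ m`, then `det B ∈ I_t(A)`
(Laplace expansion along the rows in `S` and the columns in `T` leaves `(m - #S - #T)`-minors of
`A`, which lie in `I_t(A)`).  In particular `det B = 0` when all `t`-minors of `A` vanish: the
classical "a determinant vanishes to order `c` at a matrix of corank `≥ c`". [folklore] -/
theorem det_mem_minorsIdeal_of_eq_off (t : ℕ) : ∀ {m : ℕ} (A B : Matrix (Fin m) (Fin m) R)
    (S T : Finset (Fin m)), (∀ i, i ∉ S → ∀ j, j ∉ T → B i j = A i j) →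
    t + S.card + T.card ≤ m → B.det ∈ minorsIdeal t A
  | 0, A, B, S, T, _, hcard => by
    have ht : t = 0 := by omega
    subst ht
    rw [minorsIdeal_zero]
    exact Submodule.mem_top
  | m + 1, A, B, S, T, hagree, hcard => by
    classical
    by_cases hT : T.Nonempty
    · -- expand along a column of `T`
      obtain ⟨j₀, hj₀⟩ := hT
      rw [Matrix.det_succ_column B j₀]
      refine Ideal.sum_mem _ fun i _ => Ideal.mul_mem_left _ _ ?_
      refine minorsIdeal_submatrix_le t A i.succAbove j₀.succAbove
        (det_mem_minorsIdeal_of_eq_off t (A.submatrix i.succAbove j₀.succAbove)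
          (B.submatrix i.succAbove j₀.succAbove)
          (univ.filter fun i' : Fin m => i.succAbove i' ∈ S)
          (univ.filter fun j : Fin m => j₀.succAbove j ∈ T) ?_ ?_)
      · intro i' hi' j hj
        simp only [Finset.mem_filter, Finset.mem_univ, true_and] at hi' hj
        exact hagree _ hi' _ hj
      · have h1 := card_filter_succAbove_mem_le i S
        have h2 := card_filter_succAbove_mem_le j₀ T
        have h3 : (S.erase i).card ≤ S.card := Finset.card_erase_le
        have h4 : (T.erase j₀).card < T.card := Finset.card_erase_lt_of_mem hj₀
        omega
    · by_cases hS : S.Nonempty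
      · -- expand along a row of `S`
        obtain ⟨i₀, hi₀⟩ := hS
        rw [Matrix.det_succ_row B i₀]
        refine Ideal.sum_mem _ fun j _ => Ideal.mul_mem_left _ _ ?_
        refine minorsIdeal_submatrix_le t A i₀.succAbove j.succAbove
          (det_mem_minorsIdeal_of_eq_off t (A.submatrix i₀.succAbove j.succAbove)
            (B.submatrix i₀.succAbove j.succAbove)
            (univ.filter fun i' : Fin m => i₀.succAbove i' ∈ S)
            (univ.filter fun j' : Fin m => j.succAbove j' ∈ T) ?_ ?_)
        · intro i' hi' j' hj'
          simp only [Finset.mem_filter, Finset.mem_univ, true_and] at hi' hj'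
          exact hagree _ hi' _ hj'
        · have h1 := card_filter_succAbove_mem_le i₀ S
          have h2 := card_filter_succAbove_mem_le j T
          have h3 : (S.erase i₀).card < S.card := Finset.card_erase_lt_of_mem hi₀
          have h4 : (T.erase j).card ≤ T.card := Finset.card_erase_le
          omega
      · -- `B = A`
        rw [Finset.not_nonempty_iff_eq_empty] at hT hS
        have hBA : B = A := Matrix.ext fun i j => hagree i (by simp [hS]) j (by simp [hT])
        rw [hBA]
        have h := det_submatrix_mem_minorsIdeal_card A id id
        rw [Fintype.card_fin] at h
        exact minorsIdeal_antitone A (t := t) (t' := m + 1) (by omega) (by simpa using h)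

/-- Point form: if all `t`-minors of `A` vanish and `B` agrees with `A` outside `#S` rows and `#T`
columns with `t + #S + #T ≤ m`, then `det B = 0`. [folklore] -/
theorem det_eq_zero_of_eq_off {t m : ℕ} {A : Matrix (Fin m) (Fin m) R} (hA : minorsIdeal t A = ⊥)
    (B : Matrix (Fin m) (Fin m) R) (S T : Finset (Fin m))
    (hagree : ∀ i, i ∉ S → ∀ j, j ∉ T → B i j = A i j) (hcard : t + S.card + T.card ≤ m) :
    B.det = 0 := by
  have h := det_mem_minorsIdeal_of_eq_off t A B S T hagree hcard
  rwa [hA, Ideal.mem_bot] at h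

end Minors

/-! ## §2 The degree-`d` component of an affine determinant of size `d + k` -/

section Affine

variable {K : Type*} [CommRing K] {σ : Type*}

/-- **Homogeneous components of an affine determinant as column-mixed determinants.**  For a
square matrix `M = M₀ + M₁(x)` of affine linear forms of size `d + k`, the degree-`d` component of
`det M` is the sum, over the `k`-sets `T` of columns, of the determinants of the matrix taking its
columns in `T` from the constant part `M₀` and the others from the linear part `M₁(x)` (the
coefficient of `ℓ^k` in the pencil determinant `det (ℓ M₀ + M₁(x))`, Landsberg 2017 §6.1.6; the
case `k = 0` is the tree's `homogeneousComponent_card_det_of_totalDegree_le_one`).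
[cite: Landsberg2017, §6.1.6] -/
theorem homogeneousComponent_det_eq_sum_powersetCard {ι : Type*} [Fintype ι] [DecidableEq ι]
    (M : Matrix ι ι (MvPolynomial σ K)) (hM : ∀ i j, (M i j).totalDegree ≤ 1) {d k : ℕ}
    (hdk : d + k = Fintype.card ι) :
    homogeneousComponent d M.det = ∑ T ∈ powersetCard k (univ : Finset ι),
      (Matrix.of fun i j =>
        if j ∈ T then C (coeff 0 (M i j)) else homogeneousComponent 1 (M i j)).det := by
  classical
  have hentry : ∀ i j, M i j = C (coeff 0 (M i j)) + homogeneousComponent 1 (M i j) :=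
    fun i j => by
      conv_lhs => rw [eq_homogeneousComponent_zero_add_one (hM i j), homogeneousComponent_zero]
  rw [Matrix.det_apply, map_sum]
  simp_rw [Matrix.det_apply]
  rw [Finset.sum_comm]
  refine Finset.sum_congr rfl fun π _ => ?_
  simp_rw [Units.smul_def]
  rw [map_zsmul, ← Finset.smul_sum]
  congr 1
  have hprod : ∏ i, M (π i) i = ∑ T ∈ (univ : Finset ι).powerset,
      (∏ i ∈ T, C (coeff 0 (M (π i) i))) * ∏ i ∈ univ \ T, homogeneousComponent 1 (M (π i) i) := by
    rw [← Finset.prod_add]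
    exact Finset.prod_congr rfl fun i _ => hentry (π i) i
  rw [hprod, map_sum]
  have hhom : ∀ T : Finset ι, ((∏ i ∈ T, C (coeff 0 (M (π i) i))) *
      ∏ i ∈ univ \ T, homogeneousComponent 1 (M (π i) i)).IsHomogeneous (univ \ T).card := by
    intro T
    have h1 : (∏ i ∈ T, (C (coeff 0 (M (π i) i)) : MvPolynomial σ K)).IsHomogeneous 0 := by
      rw [← map_prod]; exact isHomogeneous_C _ _
    have h2 := IsHomogeneous.prod (univ \ T) (fun i => homogeneousComponent 1 (M (π i) i))
      (fun _ => 1) (fun i _ => homogeneousComponent_isHomogeneous 1 _)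
    simp only [sum_const, smul_eq_mul, mul_one] at h2
    simpa only [zero_add] using h1.mul h2
  have hcomp : ∀ T : Finset ι, homogeneousComponent d ((∏ i ∈ T, C (coeff 0 (M (π i) i))) *
      ∏ i ∈ univ \ T, homogeneousComponent 1 (M (π i) i)) =
      if T.card = k then (∏ i ∈ T, C (coeff 0 (M (π i) i))) *
        ∏ i ∈ univ \ T, homogeneousComponent 1 (M (π i) i) else 0 := by
    intro T
    rw [homogeneousComponent_of_mem (hhom T), Finset.card_univ_sdiff]
    have hT : T.card ≤ Fintype.card ι := Finset.card_le_univ T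
    by_cases h : T.card = k
    · rw [if_pos h, if_pos (by omega)]
    · rw [if_neg h, if_neg (by omega)]
  simp_rw [hcomp]
  rw [← Finset.sum_filter, ← Finset.powersetCard_eq_filter]
  refine Finset.sum_congr rfl fun T _ => ?_
  simp only [Matrix.of_apply]
  rw [Finset.prod_ite, Finset.filter_mem_eq_inter, Finset.univ_inter, Finset.filter_notMem_eq_sdiff]

end Affine

/-! ## §3 The degree-`d` component and its gradient vanish where the linear part has rank `≤ d - 2` -/

section LowRank

variable {K : Type*} [CommRing K] {σ : Type*}

/-- **Value.**  For an affine square matrix `M = M₀ + M₁(x)` of size `d + k` and a point `ξ` at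
which all `(d-1)`-minors of the linear part `M₁(ξ)` vanish (corank `≥ k + 2`), the degree-`d`
component of `det M` vanishes at `ξ`: each column-mixed determinant of
`homogeneousComponent_det_eq_sum_powersetCard` agrees with `M₁(ξ)` off `k` columns
(`det_eq_zero_of_eq_off`, `(d - 1) + k ≤ d + k`). [folklore] -/
theorem eval_homogeneousComponent_det_eq_zero {m d k : ℕ} (hdk : d + k = m)
    (M : Matrix (Fin m) (Fin m) (MvPolynomial σ K)) (hM : ∀ i j, (M i j).totalDegree ≤ 1)
    (ξ : σ → K) (hξ : minorsIdeal (d - 1) ((M.map (homogeneousComponent 1)).map (eval ξ)) = ⊥) :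
    eval ξ (homogeneousComponent d M.det) = 0 := by
  classical
  rw [homogeneousComponent_det_eq_sum_powersetCard M hM (k := k) (by rw [Fintype.card_fin, hdk]),
    map_sum]
  refine Finset.sum_eq_zero fun T hT => ?_
  have hTk : T.card = k := (Finset.mem_powersetCard.1 hT).2
  rw [RingHom.map_det, RingHom.mapMatrix_apply]
  refine det_eq_zero_of_eq_off hξ _ ∅ T (fun i _ j hj => ?_) ?_
  · rw [Matrix.map_apply, Matrix.of_apply, if_neg hj, Matrix.map_apply, Matrix.map_apply]
  · rw [Finset.card_empty, hTk]; omega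

/-- **Gradient.**  Under the same hypothesis every first partial derivative of the degree-`d`
component of `det M` vanishes at `ξ` (provided `d ≥ 1`): differentiating a column-mixed determinant
row by row (`VonZurGathen.derivation_det`) produces determinants agreeing with `M₁(ξ)` off ONE row
and `k` columns, and `(d - 1) + 1 + k ≤ d + k` (`det_eq_zero_of_eq_off`).  This is the statement
"`hc_d det (M₀ + M₁)` is singular along the corank-`(k+2)` locus of `M₁`". [folklore] -/
theorem eval_pderiv_homogeneousComponent_det_eq_zero {m d k : ℕ} (hdk : d + k = m) (hd : 1 ≤ d)
    (M : Matrix (Fin m) (Fin m) (MvPolynomial σ K)) (hM : ∀ i j, (M i j).totalDegree ≤ 1)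
    (ξ : σ → K) (hξ : minorsIdeal (d - 1) ((M.map (homogeneousComponent 1)).map (eval ξ)) = ⊥)
    (a : σ) : eval ξ (pderiv a (homogeneousComponent d M.det)) = 0 := by
  classical
  rw [homogeneousComponent_det_eq_sum_powersetCard M hM (k := k) (by rw [Fintype.card_fin, hdk]),
    map_sum, map_sum]
  refine Finset.sum_eq_zero fun T hT => ?_
  have hTk : T.card = k := (Finset.mem_powersetCard.1 hT).2
  rw [VonZurGathen.derivation_det, map_sum]
  refine Finset.sum_eq_zero fun r _ => ?_
  rw [RingHom.map_det, RingHom.mapMatrix_apply, Matrix.map_updateRow]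
  refine det_eq_zero_of_eq_off hξ _ {r} T (fun i hi j hj => ?_) ?_
  · rw [Finset.mem_singleton] at hi
    rw [Matrix.updateRow_ne hi, Matrix.map_apply, Matrix.of_apply, if_neg hj, Matrix.map_apply,
      Matrix.map_apply]
  · rw [Finset.card_singleton, hTk]; omega

end LowRank

/-! ## §4 Points of corank `≥ c` of a linear matrix exist in more than `c²` variables (Eagon–Northcott) -/

section Points

/-- **A square matrix of linear forms in `w > (m - t + 1)²` variables over `ℂ` has a NONZERO point
at which all its `t`-minors vanish** (`t ≥ 1`).  The ideal `I_t(L)` of `t`-minors is homogeneous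
(each minor is a form of degree `t`), proper (inside the irrelevant ideal), of height
`≤ (m - t + 1)²` by Eagon–Northcott (`height_minorsIdeal_le`, Matsumura Thm. 13.10 / Bruns–Vetter
Thm. 2.1, PROVED in the tree), hence `< w`; a homogeneous ideal of height `< w` in `w` variables has
a nonzero zero (`exists_ne_zero_common_zero_of_isHomogeneous_of_height_lt`).
[cite: Matsumura1987, Thm. 13.10] -/
theorem exists_ne_zero_minorsIdeal_eval_eq_bot {w m t : ℕ}
    (L : Matrix (Fin m) (Fin m) (MvPolynomial (Fin w) ℂ)) (hL : ∀ i j, (L i j).IsHomogeneous 1)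
    (ht : 1 ≤ t) (hw : (m - t + 1) * (m - t + 1) < w) :
    ∃ ξ : Fin w → ℂ, ξ ≠ 0 ∧ minorsIdeal t (L.map (eval ξ)) = ⊥ := by
  classical
  letI : GradedAlgebra (homogeneousSubmodule (Fin w) ℂ) := MvPolynomial.gradedAlgebra
  set I : Ideal (MvPolynomial (Fin w) ℂ) := minorsIdeal t L with hIdef
  -- the generators are forms of degree `t`
  have hgen : ∀ (ρ γ : Fin t → Fin m), ((L.submatrix ρ γ).det).IsHomogeneous t := fun ρ γ => by
    simpa [Fintype.card_fin] using
      AlperBogartVelasco.isHomogeneous_det_of_linear (L.submatrix ρ γ) fun i j => hL (ρ i) (γ j)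
  have hIhom : I.IsHomogeneous (homogeneousSubmodule (Fin w) ℂ) := by
    rw [hIdef, minorsIdeal]
    refine Ideal.homogeneous_span (𝒜 := homogeneousSubmodule (Fin w) ℂ) _ ?_
    rintro x ⟨⟨ρ, γ⟩, rfl⟩
    exact ⟨t, (mem_homogeneousSubmodule t _).2 (hgen ρ γ)⟩
  -- `I` is proper: it lies in the irrelevant ideal
  have hItop : I ≠ ⊤ := by
    intro htop
    have hle : I ≤ RingHom.ker (constantCoeff : MvPolynomial (Fin w) ℂ →+* ℂ) := by
      rw [hIdef, minorsIdeal, Ideal.span_le]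
      rintro x ⟨⟨ρ, γ⟩, rfl⟩
      rw [SetLike.mem_coe, RingHom.mem_ker, constantCoeff_eq]
      exact (hgen ρ γ).coeff_eq_zero (by rw [map_zero]; omega)
    rw [htop, top_le_iff] at hle
    have h1 : (1 : MvPolynomial (Fin w) ℂ) ∈ RingHom.ker (constantCoeff : MvPolynomial (Fin w) ℂ →+* ℂ) := by
      rw [hle]; exact Submodule.mem_top
    rw [RingHom.mem_ker, map_one] at h1
    exact one_ne_zero h1
  have hlt : I.height < w :=
    lt_of_le_of_lt (height_minorsIdeal_le t L hItop) (by exact_mod_cast hw)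
  obtain ⟨ξ, hξ, hvan⟩ := exists_ne_zero_common_zero_of_isHomogeneous_of_height_lt I hIhom hlt
  refine ⟨ξ, hξ, ?_⟩
  rw [minorsIdeal, Ideal.span_eq_bot]
  rintro x ⟨⟨ρ, γ⟩, rfl⟩
  show ((L.map (eval ξ)).submatrix ρ γ).det = 0
  rw [Matrix.submatrix_map, ← RingHom.mapMatrix_apply, ← RingHom.map_det]
  exact hvan _ (det_submatrix_mem_minorsIdeal t L ρ γ)

end Points

end Summit.ValiantsHypothesis.ValiantsHypothesis.Theorems.BarrierLever.DcConstantExcess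

end
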